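import Summits.Ventures.AbcSig.Rows.TemplateAB
import Summits.Ventures.AbcSig.Levels.N218
import Summits.Ventures.AbcSig.Levels.N3488

/-!
# Venture AbcSig — ROW `C2aL109A3AB`: `109^m·xⁿ + 2^a·yⁿ = z²` (SECOND coefficient distribution of the cell; the distribution `xⁿ + 2^a·109^m·yⁿ = z²` is `Rows/C2aL109A3.lean`), class `a 3` (GENERATED by plean/leanrow.py)

HONEST FRAMING. A row of a COMPUTATION cell (`pub-abcsig`); a CONDITIONAL theorem, no claim on ABC or any summit.
Hypotheses: `BS04Package` (CITED), `DataComplete` at levels [218, 3488] (COMPUTED, two-engine certified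
level files), and the listed per-orbit exclusions `hX_…` (CITED; the
row's R5 cell names each). Everything else is kernel-checked (`Rows/TemplateAB.lean`, `Levels/N….lean` — the SAME level files as the first distribution). Exponent
range: prime `n ≥ 11`, `n ≠ 109`; `B = 2^a 109^m` with `a, m < n` (n-th-power free).
Row of record:  (sha256 ; SIGNED 2026-08-22T12:17:58Z by referee (ref-g8)); its R0: THEOREM (uses CITED arithmetic facts) for all primes n >= 11 with n coprime to 872 — class: candidate (a ∈ {0,3} cell, BATCH-03; lit/COVERAGE §C2 + I–K 2006 Thm. Exponents left open by the row of record are excluded here via ; kernel-sieve residuals the row of record closes by a cell module (M6 Eisenstein / M4 Kraus certificates) appear as CITED hypotheses .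
-/

namespace Summit.Ventures.AbcSig

/-- Row `C2aL109A3AB`: second coefficient distribution `109^m·xⁿ + 2^a·yⁿ = z²` (see module docstring). -/
theorem row_C2aL109A3AB (M : NewformModel) (hP : M.BS04Package)
    (hD218 : M.DataComplete 218 level218Orbits) (hD3488 : M.DataComplete 3488 level3488Orbits)
    (n : ℕ) (hn : n.Prime) (hmin : 11 ≤ n) (hnℓ : n ≠ 109) (m : ℕ) (hm : 1 ≤ m) (hmn : m < n)
    (hX_orbit_218_3 : n ∈ ([11] : List ℕ) → M.Excludes 218 orbit_218_3 (famAB (109 ^ m) (2 ^ 3) n (fun _ _ => True)))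
    (hX_orbit_3488_6 : n ∈ ([7, 13] : List ℕ) → M.Excludes 3488 orbit_3488_6 (famAB (109 ^ m) (2 ^ 3) n (fun _ _ => True)))
    (hX_orbit_3488_7 : n ∈ ([29] : List ℕ) → M.Excludes 3488 orbit_3488_7 (famAB (109 ^ m) (2 ^ 3) n (fun _ _ => True)))
    (hX_orbit_3488_10 : n ∈ ([17] : List ℕ) → M.Excludes 3488 orbit_3488_10 (famAB (109 ^ m) (2 ^ 3) n (fun _ _ => True)))
    (x y z : ℤ) (hxy1 : x * y ≠ 1) (hxy2 : x * y ≠ -1) : ¬ IsPrimitiveSolution (109 ^ m) (2 ^ 3) 1 n x y z := by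
  have hℓ : Nat.Prime 109 := by norm_num
  have h7 : 7 ≤ n := by omega
  have hS218 :=
    (level218_sieve n hn h7 (fun o => M.Excludes 218 o (famAB (109 ^ m) (2 ^ 3) n (fun _ _ => True))) (fun h => absurd h (by simp only [List.mem_cons, List.not_mem_nil, or_false]; omega)) (fun h => absurd h (by simp only [List.mem_cons, List.not_mem_nil, or_false]; omega)) hX_orbit_218_3)
  have hS3488 :=
    (level3488_sieve n hn h7 (fun o => M.Excludes 3488 o (famAB (109 ^ m) (2 ^ 3) n (fun _ _ => True))) (fun h => absurd h (by simp only [List.mem_cons, List.not_mem_nil, or_false]; omega)) (fun h => absurd h (by simp only [List.mem_cons, List.not_mem_nil, or_false]; omega)) hX_orbit_3488_6 hX_orbit_3488_7 hX_orbit_3488_10)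
  exact rowC2aAB_a3 109 hℓ (by norm_num) M hP n hn h7 hnℓ hD3488 hD218 m hm hmn
    hS3488
    hS218 x y z hxy1 hxy2

end Summit.Ventures.AbcSig
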